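import Summits.HubbardSuperconductivity.HubbardLadder.Bounds.ComplexFugacityTwistInsensitivity
import Summits.HubbardSuperconductivity.HubbardLadder.Bounds.ComplexFugacitySingleSite
import HarnessLib

/-!
# Off the arc: the volume contraction of the generalised Gibbs factor at complex fugacity

HONEST FRAMING (cell pub-hubbard): ladder R1–R4 with certified numbers; no claim on H/H₀. Bounds for
model classes (the seam-twisted translation-invariant `t–t'` Hubbard torus at a complex chemical
potential), no materials claim. Imports only landed modules and parts F3 / S of this device
(`ComplexFugacityTwistInsensitivity` = LEAN FILING REQUEST #211.3, `ComplexFugacitySingleSite` =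
#211.4).

This is part F4 of the kernel device for bounds.tex Theorem 13 (canonical no-stiffness) in the
N-sector form: bounds.tex §13, Lemma 13.2 — at a complex fugacity `w = βμ` OFF the arc
`|Im w| ≤ φ₀` every EMPTY site of a polymer configuration loses the factor `|z(w)|/z(Re w) ≤ e^{-κ}`,
while the occupied sites are paid for by the Kotecký–Preiss entropy bound with site weight `e^{κ}`;
the generalised Gibbs factor is therefore exponentially small in the volume compared with
`z(Re w)^{|Λ|}`.

THEOREMS (0 sorry).
* `norm_polymerPartitionFunction_le_pow_mul_exp` — the abstract volume lemma for a subset polymer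
  gas on a finite set `α` (`|α| = n`): if `ρ ∅ = 0`, `e^{κ} ≤ r` and the one-site sums
  `Σ_{A ∋ x} |ρ A| r^{-|A|} e^{κ|A|} ≤ S`, then `|Ξ(ρ)| ≤ r^{n} e^{(S-κ) n}` (disjointness of compatible
  families: `sum_card_le_card_of_isCompatible`).
* `sum_norm_couplingActivity_div_pow_mul_exp_le` — the `r`-free one-site Kotecký–Preiss sum of the
  RESCALED coupling-function activities `|ρ(A)| r^{-|A|}` at complex fugacity (Catalan × Hölder form,
  `e^{a} + W F² ≤ F ⟹ Σ_{A∋x} |ρ(A)| r^{-|A|} e^{a|A|} ≤ F - e^{a}`), and its `t–t'` torus instance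
  `sum_norm_ttActivityMu_div_pow_mul_exp_le` (`W = 16 s e^{2s}`, `s = |β|(1+|t'|)`).
* **`norm_Zc_ttFluxCoupling_le_of_exp_le_siteRatio`** — for `L ≥ 3`, real `β, t', U, θ`, complex `μ`
  with `z₀(β,U,μ) ≠ 0`, `κ ≥ 0`, `e^{κ} ≤ r = siteRatio β U μ` and `e^{κ} + 16 s e^{2s} F² ≤ F`:
  `‖Zc(β,U,μ; c_θ)‖ ≤ (‖z₀‖ r)^{L²} · exp((F - e^{κ} - κ) L²)`, where `‖z₀‖ r = z₀(1, βU, Re βμ)` is the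
  real one-site partition function at the real part of the fugacity
  (`norm_atomicPartitionFn_mul_siteRatio`).
* `exp_le_siteRatio_of_offarc` — off the arc (`cos (Im w) ≤ c₀ ≤ 1`, `|βU| ≤ u₀`) the hypothesis
  `e^{κ} ≤ r` holds with part S's density-dependent `κ = (1-c₀) n(2-n)/((1+e^{u₀})(1+e^{u₀/2}))`;
  `norm_Zc_ttFluxCoupling_le_offarc` is the combined statement (bounds.tex (13.3), N-sector form).

References: bounds.tex §13 (Lemma 13.2, (13.3)); D. Ueltschi, J. Stat. Phys. 95 (1999) 693, §2.3
[Ueltschi1999]; R. Kotecký, D. Preiss, Comm. Math. Phys. 103 (1986) 491, Theorem p. 492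
[KoteckyPreiss1986]; C. Borgs, R. Kotecký, J. Stat. Phys. 61 (1990) 79 (contour/polymer bounds at
complex fields) [folklore use only].
-/

noncomputable section

namespace Summit.HubbardSuperconductivity.HubbardLadder.Bounds

open Matrix Finset Literature.MathematicalPhysics.QuantumLattice Literature.Probability.LatticeModels

/-! ### The abstract volume lemma for subset polymer gases -/

section Volume

variable {α : Type*} [Fintype α] [DecidableEq α]

omit [Fintype α] in
/-- Distinct members of a `polyInc`-compatible family of site sets are disjoint. [folklore] -/
theorem disjoint_of_isCompatible_polyInc {𝒜 : Finset (Finset α)} (h : IsCompatible polyInc 𝒜)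
    {γ γ' : Finset α} (hγ : γ ∈ 𝒜) (hγ' : γ' ∈ 𝒜) (hne : γ ≠ γ') : Disjoint γ γ' := by
  have h' : ¬ polyInc γ γ' := h (Finset.mem_coe.2 hγ) (Finset.mem_coe.2 hγ') hne
  rw [polyInc, not_or, Finset.not_nonempty_iff_eq_empty] at h'
  exact Finset.disjoint_iff_inter_eq_empty.2 h'.2

/-- A `polyInc`-compatible family of site sets has total cardinality at most `|α|`. [folklore] -/
theorem sum_card_le_card_of_isCompatible {𝒜 : Finset (Finset α)} (h : IsCompatible polyInc 𝒜) :
    ∑ γ ∈ 𝒜, γ.card ≤ Fintype.card α := by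
  have hd : (𝒜 : Set (Finset α)).PairwiseDisjoint id := fun γ hγ γ' hγ' hne =>
    disjoint_of_isCompatible_polyInc h (Finset.mem_coe.1 hγ) (Finset.mem_coe.1 hγ') hne
  have := Finset.card_biUnion hd
  simp only [id] at this
  rw [← this]
  exact Finset.card_le_univ _

/-- The sum of a nonnegative set function over all subsets is at most the sum over sites of its
one-site sums, provided it vanishes at `∅`. [folklore] -/
theorem sum_powerset_le_sum_sum_filter_mem {g : Finset α → ℝ} (hg : ∀ A, 0 ≤ g A) (h0 : g ∅ = 0) :
    ∑ A ∈ (Finset.univ : Finset α).powerset, g A ≤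
      ∑ x : α, ∑ A ∈ (Finset.univ : Finset α).powerset.filter (fun A => x ∈ A), g A := by
  have h1 : ∀ A ∈ (Finset.univ : Finset α).powerset, g A ≤ ∑ x : α, if x ∈ A then g A else 0 := by
    intro A _
    rw [← Finset.sum_filter, Finset.filter_mem_eq_inter, Finset.univ_inter, Finset.sum_const,
      nsmul_eq_mul]
    rcases A.eq_empty_or_nonempty with rfl | hA
    · simp [h0]
    · have : (1 : ℝ) ≤ A.card := by exact_mod_cast Finset.card_pos.2 hA
      nlinarith [hg A]
  refine (Finset.sum_le_sum h1).trans ?_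
  rw [Finset.sum_comm]
  refine Finset.sum_le_sum fun x _ => ?_
  rw [Finset.sum_filter]

/-- **The abstract off-arc volume lemma.** For a subset polymer gas on a finite set `α` with
`|α| = n`, activities `ρ` with `ρ ∅ = 0`, a ratio `r ≥ e^{κ}` and one-site sums
`Σ_{A ∋ x} |ρ A| r^{-|A|} e^{κ|A|} ≤ S` at every site: `|Ξ(ρ)| ≤ r^{n} e^{(S-κ) n}`. Mechanism: a compatible
family `γ₁,…,γ_k` is pairwise disjoint, so `∏ |ρ γ_j| = (r e^{-κ})^{Σ|γ_j|} ∏ (|ρ γ_j| r^{-|γ_j|} e^{κ|γ_j|})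
≤ (r e^{-κ})^{n} ∏ g(γ_j)`, and `Σ_{families} ∏ g ≤ ∏_A (1 + g A) ≤ exp(Σ_A g A) ≤ e^{nS}`.
[programme: bounds.tex §13 Lemma 13.2; folklore polymer-gas majorisation] -/
theorem norm_polymerPartitionFunction_le_pow_mul_exp {ρ : Finset α → ℂ} (h0 : ρ ∅ = 0) {r κ S : ℝ}
    (hκr : Real.exp κ ≤ r)
    (hS : ∀ x : α, ∑ A ∈ (Finset.univ : Finset α).powerset.filter (fun A => x ∈ A),
      ‖ρ A‖ / r ^ A.card * Real.exp (κ * A.card) ≤ S) :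
    ‖polymerPartitionFunction polyInc ρ (Finset.univ : Finset α).powerset‖ ≤
      r ^ Fintype.card α * Real.exp ((S - κ) * Fintype.card α) := by
  set n := Fintype.card α with hn
  have hr : 0 < r := lt_of_lt_of_le (Real.exp_pos κ) hκr
  set q := r * Real.exp (-κ) with hq
  have hq1 : 1 ≤ q := by
    rw [hq]
    have : Real.exp κ * Real.exp (-κ) = 1 := by rw [← Real.exp_add, add_neg_cancel, Real.exp_zero]
    nlinarith [Real.exp_pos (-κ)]
  set g : Finset α → ℝ := fun A => ‖ρ A‖ / r ^ A.card * Real.exp (κ * A.card) with hg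
  have hg0 : ∀ A, 0 ≤ g A := fun A => by positivity
  have hge : g ∅ = 0 := by simp [hg, h0]
  -- the per-polymer identity `|ρ A| = q^{|A|} g(A)`
  have hρg : ∀ A, ‖ρ A‖ = q ^ A.card * g A := by
    intro A
    have hrA : r ^ A.card ≠ 0 := pow_ne_zero _ hr.ne'
    rw [hg, hq, mul_pow, ← Real.exp_nat_mul]
    field_simp
    rw [mul_assoc, ← Real.exp_add]
    simp
  -- termwise bound for the families
  have hterm : ∀ 𝒜 ∈ (Finset.univ : Finset α).powerset.powerset,
      ‖(if IsCompatible polyInc 𝒜 then ∏ γ ∈ 𝒜, ρ γ else 0 : ℂ)‖ ≤ q ^ n * ∏ γ ∈ 𝒜, g γ := by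
    intro 𝒜 _
    split_ifs with hc
    · rw [norm_prod, Finset.prod_congr rfl fun γ _ => hρg γ, Finset.prod_mul_distrib,
        Finset.prod_pow_eq_pow_sum]
      exact mul_le_mul_of_nonneg_right (pow_le_pow_right₀ hq1 (sum_card_le_card_of_isCompatible hc))
        (Finset.prod_nonneg fun γ _ => hg0 γ)
    · rw [norm_zero]; exact mul_nonneg (by positivity) (Finset.prod_nonneg fun γ _ => hg0 γ)
  -- the sum over all families is `∏ (1 + g)` which is at most `exp (Σ g) ≤ exp (n S)`
  have hsumg : ∑ A ∈ (Finset.univ : Finset α).powerset, g A ≤ n * S := by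
    refine (sum_powerset_le_sum_sum_filter_mem hg0 hge).trans ?_
    calc ∑ x : α, ∑ A ∈ (Finset.univ : Finset α).powerset.filter (fun A => x ∈ A), g A
        ≤ ∑ _x : α, S := Finset.sum_le_sum fun x _ => hS x
      _ = n * S := by rw [Finset.sum_const, nsmul_eq_mul, Finset.card_univ]
  have hprod : ∑ 𝒜 ∈ (Finset.univ : Finset α).powerset.powerset, ∏ γ ∈ 𝒜, g γ ≤ Real.exp (n * S) := by
    rw [← Finset.prod_one_add]
    calc ∏ A ∈ (Finset.univ : Finset α).powerset, (1 + g A)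
        ≤ ∏ A ∈ (Finset.univ : Finset α).powerset, Real.exp (g A) :=
          Finset.prod_le_prod (fun A _ => by linarith [hg0 A]) fun A _ => by
            linarith [Real.add_one_le_exp (g A)]
      _ = Real.exp (∑ A ∈ (Finset.univ : Finset α).powerset, g A) := (Real.exp_sum _ _).symm
      _ ≤ Real.exp (n * S) := Real.exp_le_exp.2 hsumg
  calc ‖polymerPartitionFunction polyInc ρ (Finset.univ : Finset α).powerset‖
      ≤ ∑ 𝒜 ∈ (Finset.univ : Finset α).powerset.powerset,
          ‖(if IsCompatible polyInc 𝒜 then ∏ γ ∈ 𝒜, ρ γ else 0 : ℂ)‖ := norm_sum_le _ _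
    _ ≤ ∑ 𝒜 ∈ (Finset.univ : Finset α).powerset.powerset, q ^ n * ∏ γ ∈ 𝒜, g γ :=
        Finset.sum_le_sum hterm
    _ = q ^ n * ∑ 𝒜 ∈ (Finset.univ : Finset α).powerset.powerset, ∏ γ ∈ 𝒜, g γ := by
        rw [Finset.mul_sum]
    _ ≤ q ^ n * Real.exp (n * S) := mul_le_mul_of_nonneg_left hprod (by positivity)
    _ = r ^ n * Real.exp ((S - κ) * n) := by
        rw [hq, mul_pow, ← Real.exp_nat_mul, mul_assoc, ← Real.exp_add]
        congr 1; congr 1; ring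

end Volume

/-! ### The `r`-free one-site sum of the rescaled activities -/

section Hubbard

variable {Λ : Type*} [LinearOrder Λ] [Fintype Λ] {D : Finset (Bond Λ)}

/-- **One-site Kotecký–Preiss sum of the RESCALED coupling-function activities at complex
fugacity.** For complex `β, U, μ` with `z₀ ≠ 0`, `r = siteRatio β U μ`, `|c_b| ≤ δ_b` on `D`, weighted
degree `Σ_{b ∈ D, v ∈ b} (e^{δ_b} - 1) ≤ W` at every site, `a ≥ 0` and `e^{a} + W F² ≤ F`: for every site
`x` and finite family `𝒜` of site sets through `x`, `Σ_{A ∈ 𝒜} |couplingActivity D c A| r^{-|A|} e^{a|A|}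
≤ F - e^{a}` — the factor `r^{|supp K|}` of part F2's activity bound is divided out instead of being
absorbed into the site weight. [folklore: KoteckyPreiss1986 condition (1) via the tree-graph bound;
Ueltschi1999 §3; bounds.tex §13 Lemma 13.2] -/
theorem sum_norm_couplingActivity_div_pow_mul_exp_le {β U μ : ℂ}
    (hz : atomicPartitionFn β U μ ≠ 0) {δ : Bond Λ → ℝ} {c : Bond Λ → ℂ} (hc : ∀ b ∈ D, ‖c b‖ ≤ δ b)
    {a W F : ℝ} (ha : 0 ≤ a)
    (hW : ∀ v : Λ, ∑ b ∈ D.filter (fun b => v ∈ Bond.verts b), (Real.exp (δ b) - 1) ≤ W)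
    (hF : Real.exp a + W * F ^ 2 ≤ F) (x : Λ) (𝒜 : Finset (Finset Λ))
    (h𝒜 : ∀ A ∈ 𝒜, x ∈ A) :
    ∑ A ∈ 𝒜, ‖couplingActivity D β U μ c A‖ / siteRatio β U μ ^ A.card * Real.exp (a * A.card) ≤
      F - Real.exp a := by
  classical
  set r := siteRatio β U μ with hr
  have hr0 : 0 < r := lt_of_lt_of_le one_pos (one_le_siteRatio hz)
  set CC := connectedCellSets Bond.verts D with hCC
  set f : Finset (Bond Λ) → ℝ := fun X =>
    ‖couplingWeight β U μ c X‖ / r ^ (cellSupp Bond.verts X).card *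
      Real.exp (a * ((cellSupp Bond.verts X).card : ℝ)) with hf
  have hf0 : ∀ X, 0 ≤ f X := fun X => by positivity
  set Sx := CC.filter fun X => x ∈ cellSupp Bond.verts X with hSx
  -- Step a: bound by a sum over connected bond sets through `x`
  have stepA : ∑ A ∈ 𝒜, ‖couplingActivity D β U μ c A‖ / r ^ A.card * Real.exp (a * A.card) ≤
      ∑ X ∈ Sx, f X := by
    have h1 : ∀ A ∈ 𝒜, ‖couplingActivity D β U μ c A‖ / r ^ A.card * Real.exp (a * A.card) ≤
        ∑ X ∈ CC.filter (fun X => cellSupp Bond.verts X = A), f X := by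
      intro A _
      rw [couplingActivity_apply, ← hCC, div_eq_mul_inv]
      refine (mul_le_mul_of_nonneg_right (mul_le_mul_of_nonneg_right (norm_sum_le _ _)
        (by positivity)) (Real.exp_nonneg _)).trans ?_
      rw [Finset.sum_mul, Finset.sum_mul]
      refine Finset.sum_le_sum fun X hX => le_of_eq ?_
      simp only [hf]
      rw [(Finset.mem_filter.1 hX).2, div_eq_mul_inv]
    refine (Finset.sum_le_sum h1).trans ?_
    rw [← Finset.sum_biUnion]
    · refine Finset.sum_le_sum_of_subset_of_nonneg ?_ fun X _ _ => hf0 X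
      intro X hX
      obtain ⟨A, hA, hXA⟩ := Finset.mem_biUnion.1 hX
      obtain ⟨hXCC, hXsupp⟩ := Finset.mem_filter.1 hXA
      exact Finset.mem_filter.2 ⟨hXCC, hXsupp ▸ h𝒜 A hA⟩
    · intro A hA B hB hAB
      refine Finset.disjoint_left.2 fun X hXA hXB => hAB ?_
      rw [← (Finset.mem_filter.1 hXA).2, ← (Finset.mem_filter.1 hXB).2]
  -- Step b: each term is at most the tree-graph weight with `w_b = e^{δ_b} - 1` and site weight `e^{a}`
  set w : Bond Λ → ℝ := fun b => Real.exp (δ b) - 1 with hw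
  have hw0 : ∀ b ∈ D, 0 ≤ w b := fun b hb => by
    have : 0 ≤ δ b := (norm_nonneg _).trans (hc b hb)
    simp only [hw, sub_nonneg]
    exact Real.one_le_exp this
  have stepB : ∀ X ∈ Sx, f X ≤ (∏ b ∈ X, w b) * Real.exp (a * ((cellSupp Bond.verts X).card : ℝ)) := by
    intro X hX
    have hXD : X ⊆ D := (mem_connectedCellSets.1 (Finset.mem_filter.1 hX).1).1
    have hb := norm_couplingWeight_le_prod_exp_sub_one_mul_siteRatio_pow hz c X
    have hP : (∏ b ∈ X, (Real.exp ‖c b‖ - 1)) ≤ ∏ b ∈ X, w b := by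
      refine Finset.prod_le_prod (fun b _ => sub_nonneg.2 (Real.one_le_exp (norm_nonneg _))) ?_
      intro b hb'
      simp only [hw, sub_le_sub_iff_right, Real.exp_le_exp]
      exact hc b (hXD hb')
    have hdiv : ‖couplingWeight β U μ c X‖ / r ^ (cellSupp Bond.verts X).card ≤ ∏ b ∈ X, w b := by
      rw [div_le_iff₀ (pow_pos hr0 _)]
      exact hb.trans (mul_le_mul_of_nonneg_right hP (pow_nonneg hr0.le _))
    exact mul_le_mul_of_nonneg_right hdiv (Real.exp_nonneg _)
  -- Step c: the Catalan entropy bound (#195.2/.3) at site weight `e^{a}`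
  calc ∑ A ∈ 𝒜, ‖couplingActivity D β U μ c A‖ / r ^ A.card * Real.exp (a * A.card)
      ≤ ∑ X ∈ Sx, f X := stepA
    _ ≤ ∑ X ∈ Sx, (∏ b ∈ X, w b) * Real.exp (a * ((cellSupp Bond.verts X).card : ℝ)) :=
        Finset.sum_le_sum stepB
    _ ≤ F - Real.exp a := sum_prod_mul_exp_card_cellSupp_le hw0 ha hW hF x

/-- `‖z₀(β,U,μ)‖ · siteRatio β U μ = z₀(1, Re βU, Re βμ)`, the real one-site partition function at the
real parts, whenever `z₀(β,U,μ) ≠ 0`. [folklore] -/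
theorem norm_atomicPartitionFn_mul_siteRatio {β U μ : ℂ} (hz : atomicPartitionFn β U μ ≠ 0) :
    ‖atomicPartitionFn β U μ‖ * siteRatio β U μ = atomicPartitionFnReal 1 (β * U).re (β * μ).re := by
  unfold siteRatio
  rw [mul_div_cancel₀ _ (norm_ne_zero_iff.2 hz)]

end Hubbard

/-! ### The seam-twisted `t–t'` torus -/

section Torus

open Literature.MathematicalPhysics.QuantumFieldTheory

variable {L : ℕ} [NeZero L]

/-- **One-site sum of the rescaled complex-fugacity activities of the `t–t'` torus**: with
`s = |β|(1+|t'|)`, `r = siteRatio β U μ`, if `z₀(β,U,μ) ≠ 0`, `a ≥ 0` and `e^{a} + 16 s e^{2s} F² ≤ F`,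
then `Σ_{A ∋ x} |ρ_θ^μ(A)| r^{-|A|} e^{a|A|} ≤ F - e^{a}` for every site `x` and every twist `θ`.
[this file; the weighted degree bound `Σ_{b ∋ v} (e^{|c_b|} - 1) ≤ 16 s e^{2s}` exactly as in part F3] -/
theorem sum_norm_ttActivityMu_div_pow_mul_exp_le (hL : 3 ≤ L) (β t' U : ℝ) {μ : ℂ} (θ : ℝ)
    (hz : atomicPartitionFn (β : ℂ) (U : ℂ) μ ≠ 0) {a F : ℝ} (ha : 0 ≤ a)
    (hF : Real.exp a + 16 * (|β| * (1 + |t'|)) * Real.exp (2 * (|β| * (1 + |t'|))) * F ^ 2 ≤ F)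
    (x : FermionTorus 2 L) (𝒜 : Finset (Finset (FermionTorus 2 L))) (h𝒜 : ∀ A ∈ 𝒜, x ∈ A) :
    ∑ A ∈ 𝒜, ‖ttActivityMu L β t' U μ θ A‖ / siteRatio (β : ℂ) (U : ℂ) μ ^ A.card *
      Real.exp (a * A.card) ≤ F - Real.exp a := by
  simp only [ttActivityMu, siteActivityC_eq_couplingActivity]
  refine sum_norm_couplingActivity_div_pow_mul_exp_le hz
    (δ := fun b => ‖ttFluxCoupling L β t' θ b‖) (fun _ _ => le_rfl) ha (fun v => ?_) hF x 𝒜 h𝒜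
  have hem : ∀ x : ℝ, Real.exp x - 1 ≤ x * Real.exp x := fun x => by
    have h2 : Real.exp x * (-x + 1) ≤ Real.exp x * Real.exp (-x) :=
      mul_le_mul_of_nonneg_left (Real.add_one_le_exp (-x)) (Real.exp_pos x).le
    rw [← Real.exp_add, add_neg_cancel, Real.exp_zero] at h2
    linarith
  have hb1 : ∀ b : Bond (FermionTorus 2 L), Real.exp ‖ttFluxCoupling L β t' θ b‖ - 1 ≤
      ‖ttFluxCoupling L β t' θ b‖ * Real.exp (2 * (|β| * (1 + |t'|))) := fun b =>
    (hem _).trans (mul_le_mul_of_nonneg_left (Real.exp_le_exp.2 (by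
      have := norm_ttFluxCoupling_le hL β t' θ b; linarith)) (norm_nonneg _))
  refine (Finset.sum_le_sum fun b _ => hb1 b).trans ?_
  rw [← Finset.sum_mul]
  exact mul_le_mul_of_nonneg_right (sum_norm_ttFluxCoupling_le β t' θ v _
    fun b hb => (@mem_verts_iff _ (_) _ _).1 ((@Finset.mem_filter _ _ (_) _ _).1 hb).2)
    (Real.exp_nonneg _)

/-- **THEOREM (off-arc volume contraction of the generalised Gibbs factor).** For `L ≥ 3`, real
`β, t', U, θ`, complex `μ` with `z₀(β,U,μ) ≠ 0`, `κ ≥ 0` with `e^{κ} ≤ r = siteRatio β U μ` and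
`e^{κ} + 16 s e^{2s} F² ≤ F` (`s = |β|(1+|t'|)`):
`‖Zc(β,U,μ; c_θ)‖ ≤ (‖z₀(β,U,μ)‖ r)^{|Λ_L|} · exp((F - e^{κ} - κ) |Λ_L|)`; here `‖z₀‖ r` is the real one-site
partition function at `Re βμ` (`norm_atomicPartitionFn_mul_siteRatio`), so the bound reads
`|Z^{gc}(A; w)| ≤ z(Re w)^{|Λ|} e^{-(κ - (F - e^{κ}))|Λ|}`. [programme: bounds.tex §13 Lemma 13.2 and
(13.3), N-sector form; this file] -/
theorem norm_Zc_ttFluxCoupling_le_of_exp_le_siteRatio (hL : 3 ≤ L) (β t' U : ℝ) {μ : ℂ} (θ : ℝ)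
    (hz : atomicPartitionFn (β : ℂ) (U : ℂ) μ ≠ 0) {κ F : ℝ} (hκ : 0 ≤ κ)
    (hκr : Real.exp κ ≤ siteRatio (β : ℂ) (U : ℂ) μ)
    (hF : Real.exp κ + 16 * (|β| * (1 + |t'|)) * Real.exp (2 * (|β| * (1 + |t'|))) * F ^ 2 ≤ F) :
    ‖Zc (β : ℂ) (U : ℂ) μ (ttFluxCoupling L β t' θ)‖ ≤
      (‖atomicPartitionFn (β : ℂ) (U : ℂ) μ‖ * siteRatio (β : ℂ) (U : ℂ) μ) ^
          Fintype.card (FermionTorus 2 L) *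
        Real.exp ((F - Real.exp κ - κ) * Fintype.card (FermionTorus 2 L)) := by
  rw [Zc_ttFluxCoupling_eq_mul_polymerPartitionFunction_complexMu hL β t' U θ hz, norm_mul,
    norm_pow, mul_pow, mul_assoc]
  refine mul_le_mul_of_nonneg_left ?_ (by positivity)
  refine norm_polymerPartitionFunction_le_pow_mul_exp (siteActivityC_empty _ _ _ _ _) hκr
    fun x => ?_
  exact sum_norm_ttActivityMu_div_pow_mul_exp_le hL β t' U θ hz hκ hF x _
    fun A hA => (Finset.mem_filter.1 hA).2

/-- **Off the arc the ratio `r` pays for `e^{κ}`.** For real `β ≠ 0`, `U`, a complex fugacity `w` with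
`cos (Im w) ≤ c₀ ≤ 1`, `|βU| ≤ u₀` and `z₀(β,U,w/β) ≠ 0`: `e^{κ} ≤ siteRatio β U (w/β)` with part S's
`κ = (1-c₀) n(2-n) / ((1+e^{u₀})(1+e^{u₀/2}))`, `n` the atomic density at the real fugacity `Re w`.
[this file; part S `norm_atomicC_le_mul_exp_neg_offarc`] -/
theorem exp_le_siteRatio_of_offarc (β U : ℝ) (hβ : β ≠ 0) (w : ℂ) (c₀ u₀ : ℝ)
    (hc : Real.cos w.im ≤ c₀) (hc1 : c₀ ≤ 1) (hv : |β * U| ≤ u₀)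
    (hz : atomicPartitionFn (β : ℂ) (U : ℂ) (w / β) ≠ 0) :
    Real.exp ((1 - c₀) * (((2 * Real.exp w.re + 2 * Real.exp (2 * w.re - β * U))
            / (1 + 2 * Real.exp w.re + Real.exp (2 * w.re - β * U)))
          * (2 - (2 * Real.exp w.re + 2 * Real.exp (2 * w.re - β * U))
            / (1 + 2 * Real.exp w.re + Real.exp (2 * w.re - β * U))))
          / ((1 + Real.exp u₀) * (1 + Real.exp (u₀ / 2)))) ≤ siteRatio (β : ℂ) (U : ℂ) (w / β) := by
  have hN : 0 < ‖1 + 2 * Complex.exp w + Complex.exp (2 * w - (β * U : ℝ))‖ := by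
    rw [← atomicPartitionFn_div_eq β U hβ w]; exact norm_pos_iff.2 hz
  rw [siteRatio_div_eq β U hβ w, le_div_iff₀ hN]
  have h := norm_atomicC_le_mul_exp_neg_offarc w (β * U) c₀ u₀ hc hc1 hv
  set κ := (1 - c₀) * (((2 * Real.exp w.re + 2 * Real.exp (2 * w.re - β * U))
            / (1 + 2 * Real.exp w.re + Real.exp (2 * w.re - β * U)))
          * (2 - (2 * Real.exp w.re + 2 * Real.exp (2 * w.re - β * U))
            / (1 + 2 * Real.exp w.re + Real.exp (2 * w.re - β * U))))
          / ((1 + Real.exp u₀) * (1 + Real.exp (u₀ / 2))) with hκ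
  have hee : Real.exp κ * Real.exp (-κ) = 1 := by rw [← Real.exp_add, add_neg_cancel, Real.exp_zero]
  calc Real.exp κ * ‖1 + 2 * Complex.exp w + Complex.exp (2 * w - (β * U : ℝ))‖
      ≤ Real.exp κ * ((1 + 2 * Real.exp w.re + Real.exp (2 * w.re - β * U)) * Real.exp (-κ)) :=
        mul_le_mul_of_nonneg_left h (Real.exp_nonneg _)
    _ = 1 + 2 * Real.exp w.re + Real.exp (2 * w.re - β * U) := by
        rw [mul_comm, mul_assoc, mul_comm (Real.exp (-κ)), hee, mul_one]

/-- **THEOREM (off-arc volume contraction, explicit form; bounds.tex (13.3), N-sector form).** For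
`L ≥ 3`, real `β ≠ 0`, `t', U, θ`, a complex fugacity `w` with `cos (Im w) ≤ c₀ ≤ 1`, `|βU| ≤ u₀`,
`z₀(β,U,w/β) ≠ 0`, the density-dependent rate `κ` of `exp_le_siteRatio_of_offarc` and
`e^{κ} + 16 s e^{2s} F² ≤ F`: `‖Zc(β,U,w/β; c_θ)‖ ≤ z(Re w)^{|Λ_L|} exp((F - e^{κ} - κ)|Λ_L|)` with
`z(s) = 1 + 2e^{s} + e^{2s-βU}`. [programme: bounds.tex §13 Lemma 13.2, (13.3); this file] -/
theorem norm_Zc_ttFluxCoupling_le_offarc (hL : 3 ≤ L) {β : ℝ} (hβ : β ≠ 0) (t' U θ : ℝ) (w : ℂ)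
    (c₀ u₀ : ℝ) (hc : Real.cos w.im ≤ c₀) (hc1 : c₀ ≤ 1) (hv : |β * U| ≤ u₀)
    (hz : atomicPartitionFn (β : ℂ) (U : ℂ) (w / β) ≠ 0) {F : ℝ}
    (hF : Real.exp ((1 - c₀) * (((2 * Real.exp w.re + 2 * Real.exp (2 * w.re - β * U))
            / (1 + 2 * Real.exp w.re + Real.exp (2 * w.re - β * U)))
          * (2 - (2 * Real.exp w.re + 2 * Real.exp (2 * w.re - β * U))
            / (1 + 2 * Real.exp w.re + Real.exp (2 * w.re - β * U))))
          / ((1 + Real.exp u₀) * (1 + Real.exp (u₀ / 2)))) +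
        16 * (|β| * (1 + |t'|)) * Real.exp (2 * (|β| * (1 + |t'|))) * F ^ 2 ≤ F) :
    ‖Zc (β : ℂ) (U : ℂ) (w / β) (ttFluxCoupling L β t' θ)‖ ≤
      (1 + 2 * Real.exp w.re + Real.exp (2 * w.re - β * U)) ^ Fintype.card (FermionTorus 2 L) *
        Real.exp ((F - Real.exp ((1 - c₀) * (((2 * Real.exp w.re + 2 * Real.exp (2 * w.re - β * U))
            / (1 + 2 * Real.exp w.re + Real.exp (2 * w.re - β * U)))
          * (2 - (2 * Real.exp w.re + 2 * Real.exp (2 * w.re - β * U))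
            / (1 + 2 * Real.exp w.re + Real.exp (2 * w.re - β * U))))
          / ((1 + Real.exp u₀) * (1 + Real.exp (u₀ / 2)))) -
          (1 - c₀) * (((2 * Real.exp w.re + 2 * Real.exp (2 * w.re - β * U))
            / (1 + 2 * Real.exp w.re + Real.exp (2 * w.re - β * U)))
          * (2 - (2 * Real.exp w.re + 2 * Real.exp (2 * w.re - β * U))
            / (1 + 2 * Real.exp w.re + Real.exp (2 * w.re - β * U))))
          / ((1 + Real.exp u₀) * (1 + Real.exp (u₀ / 2)))) * Fintype.card (FermionTorus 2 L)) := by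
  -- the rate is nonnegative: `0 ≤ n ≤ 2`
  set e1 := 2 * Real.exp w.re + 2 * Real.exp (2 * w.re - β * U) with he1
  set z := 1 + 2 * Real.exp w.re + Real.exp (2 * w.re - β * U) with hzdef
  have hzpos : 0 < z := by positivity
  have hn0 : 0 ≤ e1 / z := by positivity
  have hn2 : e1 / z ≤ 2 := by
    rw [div_le_iff₀ hzpos, he1, hzdef]; nlinarith [Real.exp_pos w.re, Real.exp_pos (2 * w.re - β * U)]
  have hκ : 0 ≤ (1 - c₀) * (e1 / z * (2 - e1 / z)) / ((1 + Real.exp u₀) * (1 + Real.exp (u₀ / 2))) := by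
    apply div_nonneg (mul_nonneg (by linarith) (mul_nonneg hn0 (by linarith))); positivity
  have h := norm_Zc_ttFluxCoupling_le_of_exp_le_siteRatio hL β t' U θ hz hκ
    (exp_le_siteRatio_of_offarc β U hβ w c₀ u₀ hc hc1 hv hz) hF
  have hzr : ‖atomicPartitionFn (β : ℂ) (U : ℂ) (w / β)‖ * siteRatio (β : ℂ) (U : ℂ) (w / β) = z := by
    have hN : ‖atomicPartitionFn (β : ℂ) (U : ℂ) (w / β)‖ ≠ 0 := norm_ne_zero_iff.2 hz
    rw [siteRatio_div_eq β U hβ w, ← atomicPartitionFn_div_eq β U hβ w, mul_div_cancel₀ _ hN]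
  rwa [hzr] at h

end Torus

end Summit.HubbardSuperconductivity.HubbardLadder.Bounds
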